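import Summits.CriticalPhenomena.CardyFormulaZ2.Theorems.CardyIKTransportIKLinearTransportStubRowCFTPKernel
import Summits.CriticalPhenomena.CardyFormulaZ2.Theorems.CardyIKTransportIKLinearTransportStubRowCFTPShift

/-!
# Stub `stub_RowCFTP` (A_dyn) — part D: THE EXACT HEAT-BATH ROW DYNAMICS EXISTS
# (fields `measurable`, `writes_row`, `cov` of `IsRowCFTP` and the one-row hypotheses `hRd`, `hPast`, `hEx`
# of `isRowCFTP_of_exact_row`, jointly — the satisfiability audit of the exactness half of (A_dyn))

Support file (`--supports stmt-CriticalPhenomena-5076`, registered sub-goal `exists_exactRowDynamics`).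
For EVERY column pattern `S` and face column `i` (no hypothesis on the types, none on the neighbour stub)
there is a row-resampling dynamics `Φ : ℤ → (environment) → Rnd → Obs → Obs` of the middle data which is
jointly measurable, rewrites only the three middle bits of the row it visits, is vertically covariant
SURELY, reads the fresh bits of its own row only, lets its new row depend on the start only through the
rows below, and is EXACT: one resampling of row `y` from `X' ∼ νmix (S ∆ {i,i+1})` in its own environment
`pinnedStat i X'` has, jointly with the statistic and on the events reading the off-middle data and the
middle rows `≤ y`, the law of `X'` — i.e. `Φ y` samples the conditional law of the middle row `y` of the
exchanged model GIVEN the pinned statistic and the middle rows below `y` (the sequential / heat-bath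
sampler of the diagram-conditioned transfer-matrix chain). By `isRowCFTP_of_exact_row` (p112711) these are
exactly the non-coalescence fields of `IsRowCFTP`; what (A_dyn) then still owes is a CHOICE of the row
kernel on the null set of impossible pasts together with certified coalescence events and local
approximants (`coal_*`, `local_approx`) — the in-mean mixing estimates of the conditioned chain.

Construction (`rowDyn i U G`): with uniform levels `U v u` read from the bits of `u` at the cell `v`
(`ps_beta_uniform`, p94321) and a ROW KERNEL `G` — a measurable function of (statistic value, level)
reproducing the law of `X'` jointly with the row statistic `rowStat i x = (pinnedStat i x, pastMid i 0 x)`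
(`ps3_exists_kernel_resampler`) — set
`Φ y p u z = setMid i y z (rowBits i 0 (G ((pshift (-y) p, pastMid i 0 (vshift (-y) z)), U (i+1, 0) (ushift (-y) u))))`:
the row-`0` heat-bath map conjugated by the vertical shifts (`pshift`, `pinnedStat_vshift`, part S), which
makes covariance an identity of the shift group; exactness at row `y` is reduced to row `0` by the
shift-invariance of `νmix (S ∆ {i,i+1}) ⊗ β` (`prod_map_shift`) and proved there from the kernel identity.
-/

noncomputable section

namespace Summit.CriticalPhenomena.CardyFormulaZ2.Theorems.IKLinearTransport.PinnedDiagramExchange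

open scoped Classical MeasureTheory ENNReal symmDiff
open Set MeasureTheory
open Literature.Probability.Percolation Literature.Probability.LatticeModels

/-! ## More row vocabulary -/

/-- The ROW STATISTIC at row `0`: (pinned statistic, middle rows below `0`). [folklore] -/
def rowStat (i : ℤ) (x : Obs) : (Obs × Set (Site 2 × Site 2)) × Obs := (pinnedStat i x, pastMid i 0 x)

/-- Reassemble a configuration from a value of the row statistic: off-middle data and middle rows `< 0`
(middle rows `≥ 0` left blank). [folklore] -/
def rowMerge (t : (Obs × Set (Site 2 × Site 2)) × Obs) : Obs := (t.1.1.1 ∪ t.2.1, t.1.1.2 ∪ t.2.2)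

/-- The pinned statistic is measurable. [folklore] -/
theorem measurable_pinnedStat (i : ℤ) : Measurable (pinnedStat i) :=
  (measurable_eraseMid i).prodMk (ps_measurable_stripDiagram i)

/-- The row statistic is measurable. [folklore] -/
theorem measurable_rowStat (i : ℤ) : Measurable (rowStat i) :=
  (measurable_pinnedStat i).prodMk (measurable_pastMid i 0)

/-- `rowMerge` is measurable. [folklore] -/
theorem measurable_rowMerge : Measurable rowMerge := by
  refine (measurable_set_iff.2 fun w => ?_).prodMk (measurable_set_iff.2 fun f => ?_)
  · simp only [mem_union]
    exact ((measurable_set_mem w).comp (measurable_fst.comp (measurable_fst.comp measurable_fst))).or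
      ((measurable_set_mem w).comp (measurable_fst.comp measurable_snd))
  · simp only [mem_union]
    exact ((measurable_set_mem f).comp (measurable_snd.comp (measurable_fst.comp measurable_fst))).or
      ((measurable_set_mem f).comp (measurable_snd.comp measurable_snd))

/-- Overwriting the middle bits of a row by themselves does nothing. [folklore] -/
theorem setMid_rowBits (i y : ℤ) (x : Obs) : setMid i y x (rowBits i y x) = x := by
  refine Prod.ext (Set.ext fun w => ?_) (Set.ext fun f => ?_)
  · simp only [setMid, rowBits, mem_setOf_eq]
    by_cases hw : w = ![i + 1, y]
    · subst hw; simp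
    · simp [hw]
  · simp only [setMid, rowBits, mem_setOf_eq]
    by_cases hf1 : f = ![i, y]
    · subst hf1; simp [ps3_face_ne i y]
    · by_cases hf2 : f = ![i + 1, y]
      · subst hf2; simp [(ps3_face_ne i y).symm]
      · simp [hf1, hf2]

/-- The configuration reassembled from the row statistic of `x`, with any row-`0` middle bits, agrees with
`x` (given the same bits) on the off-middle data and the middle rows `≤ 0`. [folklore] -/
theorem setMid_rowMerge_agree (i : ℤ) (x : Obs) (B : Prop × Prop × Prop) :
    (∀ w : Site 2, (w 1 < 0 + 1 ∨ w 0 ≠ i + 1) →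
      (w ∈ (setMid i 0 x B).1 ↔ w ∈ (setMid i 0 (rowMerge (rowStat i x)) B).1)) ∧
    (∀ f : Site 2, (f 1 < 0 + 1 ∨ (f 0 ≠ i ∧ f 0 ≠ i + 1)) →
      (f ∈ (setMid i 0 x B).2 ↔ f ∈ (setMid i 0 (rowMerge (rowStat i x)) B).2)) := by
  refine ⟨fun w hw => ?_, fun f hf => ?_⟩
  · by_cases h : w = ![i + 1, 0]
    · subst h; rw [(rowBits_setMid i 0 x B).1, (rowBits_setMid i 0 _ B).1]
    · rw [(setMid_off i 0 x B).1 w h, (setMid_off i 0 _ B).1 w h]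
      simp only [rowMerge, rowStat, pinnedStat, eraseMid, pastMid, mem_union, mem_setOf_eq]
      have key : w 0 ≠ i + 1 ∨ (w 0 = i + 1 ∧ w 1 < 0) := by
        by_cases h0 : w 0 = i + 1
        · right
          refine ⟨h0, ?_⟩
          have h1 : w 1 ≠ 0 := fun h1 => h (by rw [ps2_eq_vec2 w, h0, h1])
          omega
        · exact Or.inl h0
      tauto
  · by_cases h1 : f = ![i, 0]
    · subst h1; rw [(rowBits_setMid i 0 x B).2.1, (rowBits_setMid i 0 _ B).2.1]
    · by_cases h2 : f = ![i + 1, 0]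
      · subst h2; rw [(rowBits_setMid i 0 x B).2.2, (rowBits_setMid i 0 _ B).2.2]
      · rw [(setMid_off i 0 x B).2 f h1 h2, (setMid_off i 0 _ B).2 f h1 h2]
        simp only [rowMerge, rowStat, pinnedStat, eraseMid, pastMid, mem_union, mem_setOf_eq]
        have key : (f 0 ≠ i ∧ f 0 ≠ i + 1) ∨ ((f 0 = i ∨ f 0 = i + 1) ∧ f 1 < 0) := by
          by_cases h0 : f 0 ≠ i ∧ f 0 ≠ i + 1
          · exact Or.inl h0
          · right
            have h0' : f 0 = i ∨ f 0 = i + 1 := by tauto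
            refine ⟨h0', ?_⟩
            have hf1 : f 1 ≠ 0 := by
              intro hf1
              rcases h0' with h0' | h0'
              · exact h1 (by rw [ps2_eq_vec2 f, h0', hf1])
              · exact h2 (by rw [ps2_eq_vec2 f, h0', hf1])
            omega
        tauto

/-- Vertical shifts carry `setMid` at row `y` to `setMid` at row `y + k`. [folklore] -/
theorem setMid_vshift (i y k : ℤ) (z : Obs) (B : Prop × Prop × Prop) :
    vshift k (setMid i y z B) = setMid i (y + k) (vshift k z) B := by
  have e1 : ∀ w : Site 2, w - ![0, k] = ![i + 1, y] ↔ w = ![i + 1, y + k] := fun w => ps3_sub_eq_vec_iff w _ _ _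
  have e2 : ∀ w : Site 2, w - ![0, k] = ![i, y] ↔ w = ![i, y + k] := fun w => ps3_sub_eq_vec_iff w _ _ _
  refine Prod.ext (Set.ext fun w => ?_) (Set.ext fun f => ?_)
  · show w - ![0, k] ∈ (setMid i y z B).1 ↔ w ∈ (setMid i (y + k) (vshift k z) B).1
    simp only [setMid, mem_setOf_eq, ne_eq, e1]
    exact Iff.rfl
  · show f - ![0, k] ∈ (setMid i y z B).2 ↔ f ∈ (setMid i (y + k) (vshift k z) B).2
    simp only [setMid, mem_setOf_eq, ne_eq, e1, e2]
    exact Iff.rfl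

/-! ## The row dynamics built from a row kernel -/

section RowDyn

variable (i : ℤ) (U : Site 2 → Rnd → ℝ) (G : ((Obs × Set (Site 2 × Site 2)) × Obs) × ℝ → Obs)

/-- THE ROW DYNAMICS from the row kernel `G` and the levels `U`: at row `y`, overwrite the three middle bits
of `z` by the row-`0` bits of `G` evaluated at the back-shifted (environment, middle rows below `y`) and the
level read at the cell `(i+1, y)`. [folklore] -/
def rowDyn (y : ℤ) (p : Obs × Set (Site 2 × Site 2)) (u : Rnd) (z : Obs) : Obs :=
  setMid i y z (rowBits i 0 (G ((pshift (-y) p, pastMid i 0 (vshift (-y) z)), U ![i + 1, 0] (ushift (-y) u))))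

/-- `rowDyn` rewrites only the middle data of the row it visits. [folklore] -/
theorem rowDyn_writes (y : ℤ) (p : Obs × Set (Site 2 × Site 2)) (u : Rnd) (z : Obs) :
    (∀ w : Site 2, w ≠ ![i + 1, y] → (w ∈ (rowDyn i U G y p u z).1 ↔ w ∈ z.1)) ∧
    (∀ f : Site 2, f ≠ ![i, y] → f ≠ ![i + 1, y] → (f ∈ (rowDyn i U G y p u z).2 ↔ f ∈ z.2)) :=
  setMid_off i y z _

/-- `rowDyn` is jointly measurable in (environment, bits, start) when `G` and the levels are. [folklore] -/
theorem rowDyn_measurable (hU : ∀ v, Measurable (U v)) (hG : Measurable G) (y : ℤ) :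
    Measurable fun t : (Obs × Set (Site 2 × Site 2)) × (Rnd × Obs) => rowDyn i U G y t.1 t.2.1 t.2.2 := by
  unfold rowDyn
  refine (measurable_setMid i y).comp ((measurable_snd.comp measurable_snd).prodMk ?_)
  refine (measurable_rowBits i 0).comp (hG.comp ?_)
  exact (((measurable_pshift (-y)).comp measurable_fst).prodMk
    ((measurable_pastMid i 0).comp ((measurable_vshift (-y)).comp (measurable_snd.comp measurable_snd)))).prodMk
    ((hU _).comp ((measurable_ushift (-y)).comp (measurable_fst.comp measurable_snd)))

/-- `rowDyn` reads the fresh bits of its own row only (indeed only those at the cell `(i+1, y)`). [folklore] -/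
theorem rowDyn_rd (hUloc : ∀ v (u u' : Rnd), (∀ k : ℕ, ((v, k) ∈ u ↔ (v, k) ∈ u')) → U v u = U v u')
    (hUcov : ∀ v (m : ℤ) (u : Rnd), U v (ushift m u) = U (v - ![0, m]) u)
    (y : ℤ) (p : Obs × Set (Site 2 × Site 2)) (z : Obs) (u u' : Rnd)
    (h : ∀ (w : Site 2) (k : ℕ), w 1 = y → ((w, k) ∈ u ↔ (w, k) ∈ u')) :
    rowDyn i U G y p u z = rowDyn i U G y p u' z := by
  have e : (![i + 1, 0] : Site 2) - ![0, -y] = ![i + 1, y] := by ext j; fin_cases j <;> simp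
  have key : U ![i + 1, 0] (ushift (-y) u) = U ![i + 1, 0] (ushift (-y) u') := by
    rw [hUcov, hUcov, e]
    exact hUloc _ u u' fun k => h _ k rfl
  unfold rowDyn
  rw [key]

/-- The new middle row of `rowDyn` depends on the start only through the rows below. [folklore] -/
theorem rowDyn_past (y : ℤ) (p : Obs × Set (Site 2 × Site 2)) (u : Rnd) (z z' : Obs)
    (h : ∀ w : Site 2, w 1 < y → (w ∈ z.1 ↔ w ∈ z'.1) ∧ (w ∈ z.2 ↔ w ∈ z'.2)) :
    (![i + 1, y] ∈ (rowDyn i U G y p u z).1 ↔ ![i + 1, y] ∈ (rowDyn i U G y p u z').1) ∧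
    (![i, y] ∈ (rowDyn i U G y p u z).2 ↔ ![i, y] ∈ (rowDyn i U G y p u z').2) ∧
    (![i + 1, y] ∈ (rowDyn i U G y p u z).2 ↔ ![i + 1, y] ∈ (rowDyn i U G y p u z').2) := by
  have hp : pastMid i 0 (vshift (-y) z) = pastMid i 0 (vshift (-y) z') := by
    refine pastMid_congr i 0 _ _ fun w hw => ?_
    have h1 : (w - ![0, -y]) 1 = w 1 - -y := (ps2_sub_vec_apply w (-y)).2
    exact h (w - ![0, -y]) (by omega)
  unfold rowDyn
  rw [(rowBits_setMid i y z _).1, (rowBits_setMid i y z _).2.1, (rowBits_setMid i y z _).2.2,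
    (rowBits_setMid i y z' _).1, (rowBits_setMid i y z' _).2.1, (rowBits_setMid i y z' _).2.2, hp]
  exact ⟨Iff.rfl, Iff.rfl, Iff.rfl⟩

/-- SURE VERTICAL COVARIANCE of `rowDyn` (an identity of the shift group). [folklore] -/
theorem rowDyn_cov (y k : ℤ) (x : Obs) (u : Rnd) (z : Obs) :
    rowDyn i U G y (pinnedStat i (vshift k x)) (ushift k u) (vshift k z) =
      vshift k (rowDyn i U G (y - k) (pinnedStat i x) u z) := by
  simp only [rowDyn, pinnedStat_vshift', pshift_pshift, ps_vshift_vshift, ps_ushift_ushift, setMid_vshift]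
  rw [show -(y - k) = -y + k by ring, show y - k + k = y by ring]

/-- The row dynamics at row `y`, in the environment of a configuration, is the row-`0` heat-bath map of the
back-shifted data, shifted forward. [folklore] -/
theorem rowDyn_eq_vshift (y : ℤ) (x : Obs) (u : Rnd) :
    rowDyn i U G y (pinnedStat i x) u x = vshift y (setMid i 0 (vshift (-y) x)
      (rowBits i 0 (G (rowStat i (vshift (-y) x), U ![i + 1, 0] (ushift (-y) u))))) := by
  simp only [rowDyn, rowStat, pinnedStat_vshift', setMid_vshift, ps_vshift_vshift, add_neg_cancel,
    ps_vshift_zero, zero_add]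

/-! ## Exactness: row `0` from the kernel identity, row `y` by shift-invariance -/

variable (S : Set ℤ)

/-- ROW-`0` EXACTNESS of the heat-bath map `x u ↦ setMid i 0 x (rowBits i 0 (G (rowStat i x, U₀ u)))` from the
kernel identity `law (rowStat x, G (rowStat x, U₀ u)) = law (rowStat x, x)`. [folklore] -/
theorem rowDyn_exact_zero (hU : ∀ v, Measurable (U v)) (hG : Measurable G)
    (hlaw : ((νmix (S ∆ {i, i + 1})).prod β).map
        (fun xu => (rowStat i xu.1, G (rowStat i xu.1, U ![i + 1, 0] xu.2))) =
      (νmix (S ∆ {i, i + 1})).map (fun x => (rowStat i x, x)))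
    (D : Set ((Obs × Set (Site 2 × Site 2)) × Obs)) (hDm : MeasurableSet D)
    (hD : ∀ (p : Obs × Set (Site 2 × Site 2)) (z z' : Obs),
      ((∀ w : Site 2, (w 1 < 0 + 1 ∨ w 0 ≠ i + 1) → (w ∈ z.1 ↔ w ∈ z'.1)) ∧
       (∀ w : Site 2, (w 1 < 0 + 1 ∨ (w 0 ≠ i ∧ w 0 ≠ i + 1)) → (w ∈ z.2 ↔ w ∈ z'.2))) →
      ((p, z) ∈ D ↔ (p, z') ∈ D)) :
    ((νmix (S ∆ {i, i + 1})).prod β)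
        {xu | (pinnedStat i xu.1, setMid i 0 xu.1 (rowBits i 0 (G (rowStat i xu.1, U ![i + 1, 0] xu.2)))) ∈ D} =
      (νmix (S ∆ {i, i + 1})) {x | (pinnedStat i x, x) ∈ D} := by
  set ν' := νmix (S ∆ {i, i + 1}) with hν'
  -- the event through the pair (statistic, kernel output)
  set D'' : Set (((Obs × Set (Site 2 × Site 2)) × Obs) × Obs) :=
    {q | (q.1.1, setMid i 0 (rowMerge q.1) (rowBits i 0 q.2)) ∈ D} with hD''
  have hD''m : MeasurableSet D'' := by
    have : Measurable fun q : ((Obs × Set (Site 2 × Site 2)) × Obs) × Obs =>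
        (q.1.1, setMid i 0 (rowMerge q.1) (rowBits i 0 q.2)) :=
      (measurable_fst.comp measurable_fst).prodMk ((measurable_setMid i 0).comp
        ((measurable_rowMerge.comp measurable_fst).prodMk ((measurable_rowBits i 0).comp measurable_snd)))
    exact this hDm
  have hagree : ∀ (x : Obs) (B : Prop × Prop × Prop),
      (pinnedStat i x, setMid i 0 x B) ∈ D ↔ (pinnedStat i x, setMid i 0 (rowMerge (rowStat i x)) B) ∈ D :=
    fun x B => hD _ _ _ (setMid_rowMerge_agree i x B)
  have hF : Measurable fun xu : Obs × Rnd => (rowStat i xu.1, G (rowStat i xu.1, U ![i + 1, 0] xu.2)) :=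
    ((measurable_rowStat i).comp measurable_fst).prodMk
      (hG.comp (((measurable_rowStat i).comp measurable_fst).prodMk ((hU _).comp measurable_snd)))
  have hJ : Measurable fun x : Obs => (rowStat i x, x) := (measurable_rowStat i).prodMk measurable_id
  have h1 : {xu : Obs × Rnd | (pinnedStat i xu.1,
        setMid i 0 xu.1 (rowBits i 0 (G (rowStat i xu.1, U ![i + 1, 0] xu.2)))) ∈ D} =
      (fun xu : Obs × Rnd => (rowStat i xu.1, G (rowStat i xu.1, U ![i + 1, 0] xu.2))) ⁻¹' D'' := by
    ext xu
    simp only [mem_setOf_eq, mem_preimage, hD'']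
    exact hagree xu.1 _
  have h2 : {x : Obs | (pinnedStat i x, x) ∈ D} = (fun x : Obs => (rowStat i x, x)) ⁻¹' D'' := by
    ext x
    simp only [mem_setOf_eq, mem_preimage, hD'']
    rw [show (rowStat i x).1 = pinnedStat i x from rfl, ← hagree x (rowBits i 0 x), setMid_rowBits]
  rw [h1, h2, ← Measure.map_apply hF hD''m, ← Measure.map_apply hJ hD''m, hlaw]

/-- EXACTNESS OF `rowDyn` AT EVERY ROW: one resampling of row `y` from `X' ∼ νmix (S ∆ {i,i+1})` in its own
environment has, jointly with the pinned statistic and on the events reading the off-middle data and the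
middle rows `≤ y`, the law of `X'` (reduction to row `0` along the shift-invariance of `νmix ⊗ β`). [folklore] -/
theorem rowDyn_exact (hU : ∀ v, Measurable (U v)) (hG : Measurable G)
    (hlaw : ((νmix (S ∆ {i, i + 1})).prod β).map
        (fun xu => (rowStat i xu.1, G (rowStat i xu.1, U ![i + 1, 0] xu.2))) =
      (νmix (S ∆ {i, i + 1})).map (fun x => (rowStat i x, x)))
    (y : ℤ) (D : Set ((Obs × Set (Site 2 × Site 2)) × Obs)) (hDm : MeasurableSet D)
    (hD : ∀ (p : Obs × Set (Site 2 × Site 2)) (z z' : Obs),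
      ((∀ w : Site 2, (w 1 < y + 1 ∨ w 0 ≠ i + 1) → (w ∈ z.1 ↔ w ∈ z'.1)) ∧
       (∀ w : Site 2, (w 1 < y + 1 ∨ (w 0 ≠ i ∧ w 0 ≠ i + 1)) → (w ∈ z.2 ↔ w ∈ z'.2))) →
      ((p, z) ∈ D ↔ (p, z') ∈ D)) :
    ((νmix (S ∆ {i, i + 1})).prod β)
        {xu | (pinnedStat i xu.1, rowDyn i U G y (pinnedStat i xu.1) xu.2 xu.1) ∈ D} =
      (νmix (S ∆ {i, i + 1})) {x | (pinnedStat i x, x) ∈ D} := by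
  set ν' := νmix (S ∆ {i, i + 1}) with hν'
  haveI : IsProbabilityMeasure ν' := isProbabilityMeasure_nuMix _
  -- the shifted event `D'` has the row-`0` reading property
  set D' : Set ((Obs × Set (Site 2 × Site 2)) × Obs) := (fun q => (pshift y q.1, vshift y q.2)) ⁻¹' D with hD'
  have hD'm : MeasurableSet D' := ((measurable_pshift y).prodMap (measurable_vshift y)) hDm
  have hD'read : ∀ (p : Obs × Set (Site 2 × Site 2)) (z z' : Obs),
      ((∀ w : Site 2, (w 1 < 0 + 1 ∨ w 0 ≠ i + 1) → (w ∈ z.1 ↔ w ∈ z'.1)) ∧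
       (∀ w : Site 2, (w 1 < 0 + 1 ∨ (w 0 ≠ i ∧ w 0 ≠ i + 1)) → (w ∈ z.2 ↔ w ∈ z'.2))) →
      ((p, z) ∈ D' ↔ (p, z') ∈ D') := by
    intro p z z' h
    simp only [hD', mem_preimage]
    refine hD _ _ _ ⟨fun w hw => ?_, fun w hw => ?_⟩
    · have e := ps2_sub_vec_apply w y
      refine h.1 (w - ![0, y]) ?_
      rw [e.1, e.2]; omega
    · have e := ps2_sub_vec_apply w y
      refine h.2 (w - ![0, y]) ?_
      rw [e.1, e.2]; omega
  -- the core row-`0` map and its measurability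
  have hcore : Measurable fun xu : Obs × Rnd =>
      setMid i 0 xu.1 (rowBits i 0 (G (rowStat i xu.1, U ![i + 1, 0] xu.2))) :=
    (measurable_setMid i 0).comp (measurable_fst.prodMk ((measurable_rowBits i 0).comp (hG.comp
      (((measurable_rowStat i).comp measurable_fst).prodMk ((hU _).comp measurable_snd)))))
  set E₀ : Set (Obs × Rnd) := {xu | (pinnedStat i xu.1,
      setMid i 0 xu.1 (rowBits i 0 (G (rowStat i xu.1, U ![i + 1, 0] xu.2)))) ∈ D'} with hE₀
  have hE₀m : MeasurableSet E₀ :=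
    (((measurable_pinnedStat i).comp measurable_fst).prodMk hcore) hD'm
  -- (1) the row-`y` event is the back-shift of the row-`0` event
  have h1 : {xu : Obs × Rnd | (pinnedStat i xu.1, rowDyn i U G y (pinnedStat i xu.1) xu.2 xu.1) ∈ D} =
      (Prod.map (vshift (-y)) (ushift (-y))) ⁻¹' E₀ := by
    ext xu
    simp only [hE₀, hD', mem_setOf_eq, mem_preimage, Prod.map_fst, Prod.map_snd, rowDyn_eq_vshift,
      pinnedStat_vshift', pshift_pshift, add_neg_cancel, pshift_zero]
  -- (2) shift-invariance of `νmix ⊗ β`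
  have h2 : (ν'.prod β) ((Prod.map (vshift (-y)) (ushift (-y))) ⁻¹' E₀) = (ν'.prod β) E₀ := by
    rw [← Measure.map_apply ((measurable_vshift (-y)).prodMap (measurable_ushift (-y))) hE₀m,
      prod_map_shift]
  -- (3) row-`0` exactness for `D'`
  have h3 : (ν'.prod β) E₀ = ν' {x | (pinnedStat i x, x) ∈ D'} :=
    rowDyn_exact_zero i U G S hU hG hlaw D' hD'm hD'read
  -- (4) shift-invariance of `νmix`
  have h4 : ν' {x | (pinnedStat i x, x) ∈ D'} = ν' {x | (pinnedStat i x, x) ∈ D} := by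
    have hset : {x : Obs | (pinnedStat i x, x) ∈ D'} = (vshift y) ⁻¹' {x | (pinnedStat i x, x) ∈ D} := by
      ext x
      simp only [hD', mem_setOf_eq, mem_preimage, pinnedStat_vshift']
    have hm : MeasurableSet {x : Obs | (pinnedStat i x, x) ∈ D} :=
      ((measurable_pinnedStat i).prodMk measurable_id) hDm
    rw [hset, ← Measure.map_apply (measurable_vshift y) hm, nuMix_map_vshift]
  rw [h1, h2, h3, h4]

end RowDyn

/-! ## The registered sub-goal -/

/-- THE EXACT HEAT-BATH ROW DYNAMICS EXISTS (registered sub-goal `exists_exactRowDynamics`): for every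
column pattern `S` and face column `i` there is a row-resampling dynamics of the middle data which is
jointly measurable, rewrites only the middle row it visits, is vertically covariant surely, reads the fresh
bits of its own row only, lets its new row depend on the start only below that row, and resamples one row
of `X' ∼ νmix (S ∆ {i,i+1})` EXACTLY given the pinned statistic and the middle rows below — the hypotheses
`hm, hW, hcov, hRd, hPast, hEx` of `isRowCFTP_of_exact_row`. [folklore] -/
theorem exists_exactRowDynamics : ∀ (S : Set ℤ) (i : ℤ),
    ∃ Φ : ℤ → Obs × Set (Site 2 × Site 2) → Rnd → Obs → Obs,
      (∀ y, Measurable fun t : (Obs × Set (Site 2 × Site 2)) × (Rnd × Obs) => Φ y t.1 t.2.1 t.2.2) ∧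
      (∀ y p u z, (∀ w : Site 2, w ≠ ![i + 1, y] → (w ∈ (Φ y p u z).1 ↔ w ∈ z.1)) ∧
        (∀ f : Site 2, f ≠ ![i, y] → f ≠ ![i + 1, y] → (f ∈ (Φ y p u z).2 ↔ f ∈ z.2))) ∧
      (∀ (y k : ℤ) (x : Obs) (u : Rnd) (z : Obs),
        Φ y (pinnedStat i (vshift k x)) (ushift k u) (vshift k z) = vshift k (Φ (y - k) (pinnedStat i x) u z)) ∧
      (∀ (y : ℤ) (p : Obs × Set (Site 2 × Site 2)) (z : Obs) (u u' : Rnd),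
        (∀ (w : Site 2) (k : ℕ), w 1 = y → ((w, k) ∈ u ↔ (w, k) ∈ u')) → Φ y p u z = Φ y p u' z) ∧
      (∀ (y : ℤ) (p : Obs × Set (Site 2 × Site 2)) (u : Rnd) (z z' : Obs),
        (∀ w : Site 2, w 1 < y → (w ∈ z.1 ↔ w ∈ z'.1) ∧ (w ∈ z.2 ↔ w ∈ z'.2)) →
        (![i + 1, y] ∈ (Φ y p u z).1 ↔ ![i + 1, y] ∈ (Φ y p u z').1) ∧
        (![i, y] ∈ (Φ y p u z).2 ↔ ![i, y] ∈ (Φ y p u z').2) ∧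
        (![i + 1, y] ∈ (Φ y p u z).2 ↔ ![i + 1, y] ∈ (Φ y p u z').2)) ∧
      (∀ (y : ℤ) (D : Set ((Obs × Set (Site 2 × Site 2)) × Obs)), MeasurableSet D →
        (∀ (p : Obs × Set (Site 2 × Site 2)) (z z' : Obs),
          ((∀ w : Site 2, (w 1 < y + 1 ∨ w 0 ≠ i + 1) → (w ∈ z.1 ↔ w ∈ z'.1)) ∧
           (∀ w : Site 2, (w 1 < y + 1 ∨ (w 0 ≠ i ∧ w 0 ≠ i + 1)) → (w ∈ z.2 ↔ w ∈ z'.2))) →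
          ((p, z) ∈ D ↔ (p, z') ∈ D)) →
        ((νmix (S ∆ {i, i + 1})).prod β) {xu | (pinnedStat i xu.1, Φ y (pinnedStat i xu.1) xu.2 xu.1) ∈ D} =
        (νmix (S ∆ {i, i + 1})) {x | (pinnedStat i x, x) ∈ D}) := by
  intro S i
  obtain ⟨U, hUm, hUloc, hUcov, hUunif⟩ := ps_beta_uniform
  obtain ⟨G, hGm, hlaw⟩ := ps3_exists_kernel_resampler (rowStat i) (measurable_rowStat i)
    (νmix (S ∆ {i, i + 1})) (isProbabilityMeasure_nuMix _) (U ![i + 1, 0]) (hUm _) (hUunif _)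
  exact ⟨rowDyn i U G, rowDyn_measurable i U G hUm hGm, rowDyn_writes i U G, rowDyn_cov i U G,
    rowDyn_rd i U G hUloc hUcov, rowDyn_past i U G, rowDyn_exact i U G S hUm hGm hlaw⟩

end Summit.CriticalPhenomena.CardyFormulaZ2.Theorems.IKLinearTransport.PinnedDiagramExchange
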